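import Summits.QuantumFields.QCD.Theses.EulerDescent
import Literature.MathematicalPhysics.QuantumFieldTheory.QCDGoldstoneBound

/-!
# `EulerDescent.HonestHeavyAnchor` (stmt-QuantumFields-16901) BY NAME from the four children of line
# `bounded_locator` — the kernel-checked SPLIT glue, landed through the gate (lead, cycle 1)

`honestHeavyAnchor_of_threshold_of_corner_of_locators : Sub₁ → Sub₂ → Sub₃ → Sub₄ → HonestHeavyAnchor` where

* `Sub₁` is VERBATIM the statement of `Summit.QuantumFields.QCD.Theses.HeavyThresholdYMBridge.ThresholdQCD` (item
  stmt-QuantumFields-8794, the unpinned heavy-threshold anchor: for `N_f ∈ {2,3}` some `M₀ ≥ 0` and ONE mass-scaling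
  regularisation carrying the full heavy body above `M₀`; inlined rather than imported so that this file does not depend on
  that route file's build state) — registered stub `stub_heavyThresholdAnchor` of
  `Cruxes/HonestHeavyAnchor/Lines/bounded_locator.lean` is this statement verbatim;
* `Sub₂` = registered stub `stub_intrinsicCorner` with its currency inlined: along every asymptotically scaling regularisation,
  EVENTUALLY the set of non-massive degenerate bare Wilson masses at `β_k` has a least upper bound `mc k`, and `mc k → 0`;
* `Sub₃` / `Sub₄` = registered stubs `stub_offsetBoundedBelow` / `stub_offsetBoundedAbove` with currencies inlined: for every
  mass-scaling, asymptotically scaling `reg` with a closing corner `mc` and the heavy body above some `M`, the renormalised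
  corner offset `(m_crit(k) − mc(k))·Z_m(k)/a_k` is eventually bounded below / above.

The four hypotheses are, after `unfold`, the four registered stub signatures of the item's active skeleton (sha 8fbdbfc2…);
this file contains NO `def` (the crux's corner set, corner clause, offset and heavy body are written out as in the route file),
so that planners can file the route-level split `HonestHeavyAnchor ← ThresholdQCD, WilsonAxisCorner, OffsetBoundedBelow,
OffsetBoundedAbove` with `--glue-by` this theorem (STRATEGY-CENSUS.md §Decomposition, recommendation (b)).

Proof (pure bookkeeping over `QCDOS.lean`, standard axioms): `Sub₁` gives `M ≥ 0`, `reg`, body; asymptotic scaling is READ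
OFF the body at the tuple `M + 1` (`IsQCDAlong` conjunct 1 reads only `β, a`); `Sub₂` gives the closing corner `mc`; `Sub₃`,
`Sub₄` put the offset eventually in `[M₁, M₂]`; Bolzano–Weierstrass (`tendsto_subseq_of_frequently_bounded`) gives `φ` strictly
increasing and `c` with `offset ∘ φ → c`; the witness is the regularisation RESTRICTED to `φ` (`QCDRegularisation.restrict`,
every clause of the crux is a tail property of the index) and RE-PINNED by `c` (`m_crit ↦ m_crit − a c/Z_m`, so that running
it at `m` is running the old one at `m − c`), with corner `mc ∘ φ` and threshold `M + |c| + 1`.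

Nothing here proves physics: Sub₁ (YM-hard, = stmt-8794), Sub₂ (Wilson-axis phase structure at fixed weak coupling),
Sub₃/Sub₄ (non-decoupling locators) are open.  What the file certifies is that they are JOINTLY SUFFICIENT for the crux, and
(`thresholdQCD_of_honestHeavyAnchor`) that Sub₁ is also NECESSARY — any proof of the crux proves item stmt-8794.
-/

namespace Summit.QuantumFields.QCD.Theorems.HonestHeavyAnchorSplit

open Filter Topology
open Literature.MathematicalPhysics.QuantumFieldTheory
open Summit.QuantumFields.QCD.Theses

variable {Nf : ℕ}

/-! ## Elementary asymptotics of a mass-scaling regularisation -/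

/-- The leading-log mass exponent `γ₀/(2β₀)` is non-negative for `N_f = 2, 3` (the one-loop beta coefficient is positive
there: asymptotic freedom; cf. the landed `ThinQCD.Registered.betaCoeff₀_pos_of_two_or_three`). [folklore] -/
theorem massExponent_nonneg (hNf : Nf = 2 ∨ Nf = 3) : 0 ≤ massExponent Nf := by
  have hb : 0 < betaCoeff₀ Nf := by
    rcases hNf with rfl | rfl <;> norm_num [betaCoeff₀] <;> positivity
  unfold massExponent gammaCoeff₀
  positivity

/-- **`a_k / Z_m(k) → 0`** for a mass-scaling regularisation with non-negative mass exponent: `Z_m(k) ≥ c/2 > 0`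
eventually (it grows like `(log a_k⁻²)^{γ₀/(2β₀)}`), while `a_k → 0`. [folklore] -/
theorem tendsto_a_div_Zm (reg : QCDRegularisation Nf) (hms : reg.HasMassScaling)
    (hγ : 0 ≤ massExponent Nf) : Tendsto (fun k => reg.a k / reg.Zm k) atTop (𝓝 0) := by
  obtain ⟨c, hc, hZ⟩ := hms
  have h1 : Tendsto (fun k => 1 / reg.a k ^ 2) atTop atTop := by
    have ha2 : Tendsto (fun k => reg.a k ^ 2) atTop (𝓝[>] 0) := by
      refine tendsto_nhdsWithin_iff.2 ⟨?_, Eventually.of_forall fun k => pow_pos (reg.a_pos k) 2⟩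
      simpa using reg.tendsto_a.pow 2
    simpa [one_div, Function.comp_def] using tendsto_inv_nhdsGT_zero.comp ha2
  have hL : Tendsto (fun k => Real.log (1 / reg.a k ^ 2)) atTop atTop := Real.tendsto_log_atTop.comp h1
  have hLγ : ∀ᶠ k in atTop, 1 ≤ Real.log (1 / reg.a k ^ 2) ^ massExponent Nf := by
    filter_upwards [hL.eventually_ge_atTop 1] with k hk
    exact Real.one_le_rpow hk hγ
  have hZ2 : ∀ᶠ k in atTop, c / 2 < reg.Zm k / Real.log (1 / reg.a k ^ 2) ^ massExponent Nf :=
    hZ.eventually_const_lt (by linarith)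
  have hZm : ∀ᶠ k in atTop, c / 2 ≤ reg.Zm k := by
    filter_upwards [hLγ, hZ2] with k h1 h2
    have hpos : 0 < Real.log (1 / reg.a k ^ 2) ^ massExponent Nf := by linarith
    rw [lt_div_iff₀ hpos] at h2
    nlinarith [h2, h1, hc]
  have hg : Tendsto (fun k => reg.a k / (c / 2)) atTop (𝓝 0) := by
    simpa using reg.tendsto_a.div_const (c / 2)
  refine squeeze_zero' (Eventually.of_forall fun k => (div_pos (reg.a_pos k) (reg.Zm_pos k)).le) ?_ hg
  filter_upwards [hZm] with k hk
  exact div_le_div_of_nonneg_left (reg.a_pos k).le (by linarith) hk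

/-- **Bolzano–Weierstrass in the `∀ᶠ` form the two locators deliver**: a real sequence eventually bounded on both sides
has a convergent subsequence. [folklore] -/
theorem exists_subseq_tendsto_of_eventually_bounded (x : ℕ → ℝ) {M₁ M₂ : ℝ}
    (hlo : ∀ᶠ k in atTop, M₁ ≤ x k) (hhi : ∀ᶠ k in atTop, x k ≤ M₂) :
    ∃ c : ℝ, ∃ φ : ℕ → ℕ, StrictMono φ ∧ Tendsto (x ∘ φ) atTop (𝓝 c) := by
  have hfr : ∃ᶠ k in atTop, x k ∈ Set.Icc M₁ M₂ := (hlo.and hhi).frequently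
  obtain ⟨c, -, φ, hφ, hlim⟩ := tendsto_subseq_of_frequently_bounded (Metric.isBounded_Icc M₁ M₂) hfr
  exact ⟨c, φ, hφ, hlim⟩

/-! ## Re-pinning the critical mass by a constant RGI offset `c`: `m_crit ↦ m_crit − a c/Z_m` (anonymous structure
update; no new definition) -/

/-- **Running the re-pinned regularisation at masses `m` IS running the original one at `m − c`.** [folklore] -/
theorem scheme_repin (reg : QCDRegularisation Nf) (c : ℝ) (m : Fin Nf → ℝ) (z shift : QCDField Nf → ℕ → ℝ) :
    ({ reg with mcrit := fun k => reg.mcrit k - reg.a k * c / reg.Zm k } : QCDRegularisation Nf).scheme m z shift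
      = reg.scheme (fun f => m f - c) z shift := by
  simp only [QCDRegularisation.scheme, QCDScheme.mk.injEq, true_and, and_true]
  funext f k
  ring

/-- The re-pinned critical mass in terms of a corner `mc` and the offset `(m_crit − mc)·Z_m/a`:
`m_crit'(k) = mc(k) + (a_k/Z_m(k))·(offset(k) − c)` (exact algebra, `a_k, Z_m(k) ≠ 0`). [folklore] -/
theorem repin_mcrit_eq (reg : QCDRegularisation Nf) (c : ℝ) (mc : ℕ → ℝ) (k : ℕ) :
    reg.mcrit k - reg.a k * c / reg.Zm k
      = mc k + reg.a k / reg.Zm k * ((reg.mcrit k - mc k) * reg.Zm k / reg.a k - c) := by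
  have ha : reg.a k ≠ 0 := (reg.a_pos k).ne'
  have hZ : reg.Zm k ≠ 0 := (reg.Zm_pos k).ne'
  field_simp
  ring

/-- The offset of the re-pinned critical mass against `mc` is the old offset minus `c` (exact algebra). [folklore] -/
theorem cornerOffset_repin (reg : QCDRegularisation Nf) (c : ℝ) (mc : ℕ → ℝ) (k : ℕ) :
    (reg.mcrit k - reg.a k * c / reg.Zm k - mc k) * reg.Zm k / reg.a k
      = (reg.mcrit k - mc k) * reg.Zm k / reg.a k - c := by
  have ha : reg.a k ≠ 0 := (reg.a_pos k).ne'
  have hZ : reg.Zm k ≠ 0 := (reg.Zm_pos k).ne'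
  field_simp
  ring

/-! ## The split glue -/

/-- **`HonestHeavyAnchor` from the four children of line `bounded_locator`.**  Hypotheses (each an open statement):
`hA` = the statement of `HeavyThresholdYMBridge.ThresholdQCD` (stmt-QuantumFields-8794, = stub `stub_heavyThresholdAnchor`,
verbatim); `hC` = stub
`stub_intrinsicCorner` (the intrinsic Wilson corner at weak coupling exists eventually and closes); `hlo`/`hhi` = stubs
`stub_offsetBoundedBelow`/`stub_offsetBoundedAbove` (the renormalised corner offset of a mass-scaling, asymptotically scaling
regularisation with a closing corner and a heavy body is eventually bounded below/above).  Conclusion: the crux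
`EulerDescent.HonestHeavyAnchor` BY NAME.  Proof: Bolzano–Weierstrass on the offset, restriction of the threshold
regularisation to the convergent subsequence, re-pinning by the subsequential limit. [folklore] -/
theorem honestHeavyAnchor_of_threshold_of_corner_of_locators :
    (∀ Nf : ℕ, Nf = 2 ∨ Nf = 3 → ∃ M₀ : ℝ, 0 ≤ M₀ ∧ ∃ reg : QCDRegularisation Nf, reg.HasMassScaling ∧
      ∀ m : Fin Nf → ℝ, (∀ f, M₀ < m f) → ∃ (z shift : QCDField Nf → ℕ → ℝ) (T : OSData (QCDField Nf) 4),
        IsQCDAlong (reg.scheme m z shift) T ∧ T.IsNontrivial QCDField.glue ∧ T.IsNonGaussian QCDField.glue ∧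
          (∀ f g : Fin Nf, f ≠ g → T.IsNontrivial (QCDField.pseudoRe f g)) ∧
            ∃ Δ > 0, T.HasMassGap Δ ∧ (reg.scheme m z shift).HasLatticeMassGap Δ) →
    (∀ Nf : ℕ, Nf = 2 ∨ Nf = 3 → ∀ reg : QCDRegularisation Nf, (reg.scheme 0 0 0).HasAsymptoticScaling →
      ∃ mc : ℕ → ℝ, (∀ᶠ k in atTop, IsLUB {μ : ℝ | ¬ (∀ (R R' : ℕ) (A : QCDLatticeObservable Nf R)
        (B : QCDLatticeObservable Nf R'), ∃ (C δ : ℝ) (S₀ : ℕ), 0 < δ ∧ ∀ S : ℕ, S₀ ≤ S → ∀ n : ℕ, n ≤ S →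
          ‖qcdLatticeConnectedCorr (reg.β k) (2 * S + 1) (fun _ : Fin Nf => μ) A B n‖ ≤ C * Real.exp (-(δ * n)))} (mc k)) ∧
        Tendsto mc atTop (𝓝 0)) →
    (∀ Nf : ℕ, Nf = 2 ∨ Nf = 3 → ∀ (reg : QCDRegularisation Nf) (mc : ℕ → ℝ) (M : ℝ), reg.HasMassScaling →
      (reg.scheme 0 0 0).HasAsymptoticScaling →
      (∀ᶠ k in atTop, IsLUB {μ : ℝ | ¬ (∀ (R R' : ℕ) (A : QCDLatticeObservable Nf R)
        (B : QCDLatticeObservable Nf R'), ∃ (C δ : ℝ) (S₀ : ℕ), 0 < δ ∧ ∀ S : ℕ, S₀ ≤ S → ∀ n : ℕ, n ≤ S →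
          ‖qcdLatticeConnectedCorr (reg.β k) (2 * S + 1) (fun _ : Fin Nf => μ) A B n‖ ≤ C * Real.exp (-(δ * n)))} (mc k)) →
      Tendsto mc atTop (𝓝 0) →
      (∀ m : Fin Nf → ℝ, (∀ f, M < m f) → ∃ (z shift : QCDField Nf → ℕ → ℝ) (T : OSData (QCDField Nf) 4),
        IsQCDAlong (reg.scheme m z shift) T ∧ T.IsNontrivial QCDField.glue ∧ T.IsNonGaussian QCDField.glue ∧
          (∀ f g : Fin Nf, f ≠ g → T.IsNontrivial (QCDField.pseudoRe f g)) ∧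
            ∃ Δ > 0, T.HasMassGap Δ ∧ (reg.scheme m z shift).HasLatticeMassGap Δ) →
      ∃ M₁ : ℝ, ∀ᶠ k in atTop, M₁ ≤ (reg.mcrit k - mc k) * reg.Zm k / reg.a k) →
    (∀ Nf : ℕ, Nf = 2 ∨ Nf = 3 → ∀ (reg : QCDRegularisation Nf) (mc : ℕ → ℝ) (M : ℝ), reg.HasMassScaling →
      (reg.scheme 0 0 0).HasAsymptoticScaling →
      (∀ᶠ k in atTop, IsLUB {μ : ℝ | ¬ (∀ (R R' : ℕ) (A : QCDLatticeObservable Nf R)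
        (B : QCDLatticeObservable Nf R'), ∃ (C δ : ℝ) (S₀ : ℕ), 0 < δ ∧ ∀ S : ℕ, S₀ ≤ S → ∀ n : ℕ, n ≤ S →
          ‖qcdLatticeConnectedCorr (reg.β k) (2 * S + 1) (fun _ : Fin Nf => μ) A B n‖ ≤ C * Real.exp (-(δ * n)))} (mc k)) →
      Tendsto mc atTop (𝓝 0) →
      (∀ m : Fin Nf → ℝ, (∀ f, M < m f) → ∃ (z shift : QCDField Nf → ℕ → ℝ) (T : OSData (QCDField Nf) 4),
        IsQCDAlong (reg.scheme m z shift) T ∧ T.IsNontrivial QCDField.glue ∧ T.IsNonGaussian QCDField.glue ∧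
          (∀ f g : Fin Nf, f ≠ g → T.IsNontrivial (QCDField.pseudoRe f g)) ∧
            ∃ Δ > 0, T.HasMassGap Δ ∧ (reg.scheme m z shift).HasLatticeMassGap Δ) →
      ∃ M₂ : ℝ, ∀ᶠ k in atTop, (reg.mcrit k - mc k) * reg.Zm k / reg.a k ≤ M₂) →
    Summit.QuantumFields.QCD.Theses.EulerDescent.HonestHeavyAnchor := by
  intro hA hC hlo hhi Nf hNf
  -- (Sub₁) the unpinned heavy-threshold anchor
  obtain ⟨M, hM, reg, hms, hbody⟩ := hA Nf hNf
  -- asymptotic scaling, read off the body at the tuple `M + 1`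
  have haf : (reg.scheme 0 0 0).HasAsymptoticScaling := by
    obtain ⟨z, shift, T, hqcd, -⟩ := hbody (fun _ => M + 1) (fun _ => lt_add_one M)
    exact hqcd.1
  -- (Sub₂) the intrinsic corner of `reg`'s couplings, closing in lattice units
  obtain ⟨mc, hcorner, hmc⟩ := hC Nf hNf reg haf
  -- (Sub₃), (Sub₄) the two locators: the offset is eventually bounded; Bolzano–Weierstrass
  obtain ⟨M₁, hM₁⟩ := hlo Nf hNf reg mc M hms haf hcorner hmc hbody
  obtain ⟨M₂, hM₂⟩ := hhi Nf hNf reg mc M hms haf hcorner hmc hbody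
  obtain ⟨c, φ, hφ, hlim⟩ :=
    exists_subseq_tendsto_of_eventually_bounded (fun k => (reg.mcrit k - mc k) * reg.Zm k / reg.a k) hM₁ hM₂
  -- restrict to `φ`, then re-pin by `c`
  have hφt : Tendsto φ atTop atTop := hφ.tendsto_atTop
  set reg₁ : QCDRegularisation Nf := reg.restrict φ hφt with hreg₁
  let reg₂ : QCDRegularisation Nf := { reg₁ with mcrit := fun k => reg₁.mcrit k - reg₁.a k * c / reg₁.Zm k }
  have hms₁ : reg₁.HasMassScaling := by
    obtain ⟨c', hc', ht⟩ := hms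
    exact ⟨c', hc', ht.comp hφt⟩
  have hoff₁ : Tendsto (fun k => (reg₁.mcrit k - mc (φ k)) * reg₁.Zm k / reg₁.a k) atTop (𝓝 c) := hlim
  have haZ₁ : Tendsto (fun k => reg₁.a k / reg₁.Zm k) atTop (𝓝 0) :=
    tendsto_a_div_Zm reg₁ hms₁ (massExponent_nonneg hNf)
  refine ⟨reg₂, mc ∘ φ, M + |c| + 1, ?_, ?_, hms₁, ?_, ?_, ?_, ?_⟩
  · -- corner: a tail property reading only `β`, untouched by re-pinning
    exact hφt.eventually hcorner
  · -- pin: the re-pinned offset is `offset ∘ φ − c → 0`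
    have h : Tendsto (fun k => (reg₁.mcrit k - mc (φ k)) * reg₁.Zm k / reg₁.a k - c) atTop (𝓝 (c - c)) :=
      hoff₁.sub_const c
    rw [sub_self] at h
    refine h.congr' (Eventually.of_forall fun k => ?_)
    exact (cornerOffset_repin reg₁ c (mc ∘ φ) k).symm
  · -- asymptotic scaling: reads only `β, a`
    obtain ⟨Λ, hΛ, ht⟩ := haf
    exact ⟨Λ, hΛ, ht.comp hφt⟩
  · -- physical branch: `m_crit₂ = mc ∘ φ + (a/Z_m)·(offset − c) → 0 > −1`
    have hD : Tendsto (fun k => (reg₁.mcrit k - mc (φ k)) * reg₁.Zm k / reg₁.a k - c) atTop (𝓝 0) := by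
      simpa using hoff₁.sub_const c
    have hlim₂ : Tendsto (fun k => reg₂.mcrit k) atTop (𝓝 0) := by
      have h := (hmc.comp hφt).add (haZ₁.mul hD)
      simp only [mul_zero, add_zero] at h
      refine h.congr (fun k => ?_)
      exact (repin_mcrit_eq reg₁ c (mc ∘ φ) k).symm
    exact hlim₂.eventually_const_lt (by norm_num)
  · -- threshold positive
    have h := abs_nonneg c
    linarith [hM]
  · -- heavy body of `reg₂` above `M + |c| + 1`: run `reg₁` (i.e. `reg` along `φ`) at `m − c > M`
    intro m hm
    have hm' : ∀ f, M < m f - c := fun f => by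
      have h1 := hm f
      have h2 := le_abs_self c
      linarith
    obtain ⟨z, shift, T, ⟨hAS, hbr, hconv⟩, hN, hG, hP, Δ, hΔ, hT, hL⟩ := hbody (fun f => m f - c) hm'
    refine ⟨fun s => z s ∘ φ, fun s => shift s ∘ φ, T, ?_, hN, hG, hP, Δ, hΔ, hT, ?_⟩
    · rw [scheme_repin]
      refine ⟨?_, fun fl => hφt.eventually (hbr fl), fun n hn σ f F hF hoffd => ?_⟩
      · obtain ⟨Λ, hΛ, ht⟩ := hAS
        exact ⟨Λ, hΛ, ht.comp hφt⟩
      · exact (hconv n hn σ f F hF hoffd).comp hφt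
    · rw [scheme_repin]
      intro R R' A B
      obtain ⟨C, hCb⟩ := hL R R' A B
      exact ⟨C, hφt.eventually hCb⟩

/-- **Sub₁ is necessary**: the crux implies the unpinned heavy-threshold anchor (verbatim the statement of
`HeavyThresholdYMBridge.ThresholdQCD`, item stmt-QuantumFields-8794) with `M₀ := M_h` — so any proof of `HonestHeavyAnchor`
proves stmt-8794, and the line's stub `stub_heavyThresholdAnchor` carries no avoidable weight. [folklore] -/
theorem thresholdQCD_of_honestHeavyAnchor (h : EulerDescent.HonestHeavyAnchor) :
    ∀ Nf : ℕ, Nf = 2 ∨ Nf = 3 → ∃ M₀ : ℝ, 0 ≤ M₀ ∧ ∃ reg : QCDRegularisation Nf, reg.HasMassScaling ∧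
      ∀ m : Fin Nf → ℝ, (∀ f, M₀ < m f) → ∃ (z shift : QCDField Nf → ℕ → ℝ) (T : OSData (QCDField Nf) 4),
        IsQCDAlong (reg.scheme m z shift) T ∧ T.IsNontrivial QCDField.glue ∧ T.IsNonGaussian QCDField.glue ∧
          (∀ f g : Fin Nf, f ≠ g → T.IsNontrivial (QCDField.pseudoRe f g)) ∧
            ∃ Δ > 0, T.HasMassGap Δ ∧ (reg.scheme m z shift).HasLatticeMassGap Δ := by
  intro Nf hNf
  obtain ⟨reg, -, Mh, -, -, hms, -, -, hMh, hbody⟩ := h Nf hNf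
  refine ⟨Mh, hMh.le, reg, hms, fun m hm => ?_⟩
  exact hbody m fun f => (hm f).le

/-- **Sub₂'s corner and Sub₃/Sub₄'s bounds are necessary AT THE WITNESS**: the crux's own regularisation has an eventual
intrinsic corner `mc` against which its offset tends to `0`, hence is eventually bounded on both sides — the locators ask
this for EVERY closing-cornered, body-carrying regularisation (the line's only strengthening of the crux besides Sub₂'s
universality over asymptotically scaling sequences). [folklore] -/
theorem witness_offset_eventually_bounded_of_honestHeavyAnchor (h : EulerDescent.HonestHeavyAnchor) (hNf : Nf = 2 ∨ Nf = 3) :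
    ∃ (reg : QCDRegularisation Nf) (mc : ℕ → ℝ),
      (∀ᶠ k in atTop, IsLUB {μ : ℝ | ¬ (∀ (R R' : ℕ) (A : QCDLatticeObservable Nf R)
        (B : QCDLatticeObservable Nf R'), ∃ (C δ : ℝ) (S₀ : ℕ), 0 < δ ∧ ∀ S : ℕ, S₀ ≤ S → ∀ n : ℕ, n ≤ S →
          ‖qcdLatticeConnectedCorr (reg.β k) (2 * S + 1) (fun _ : Fin Nf => μ) A B n‖ ≤ C * Real.exp (-(δ * n)))} (mc k)) ∧
      (∀ᶠ k in atTop, (-1 : ℝ) ≤ (reg.mcrit k - mc k) * reg.Zm k / reg.a k) ∧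
      (∀ᶠ k in atTop, (reg.mcrit k - mc k) * reg.Zm k / reg.a k ≤ 1) := by
  obtain ⟨reg, mc, Mh, hcorner, hpin, -⟩ := h Nf hNf
  refine ⟨reg, mc, hcorner, ?_, ?_⟩
  · exact (hpin.eventually_const_lt (by norm_num : (-1 : ℝ) < 0)).mono fun k hk => hk.le
  · exact (hpin.eventually_lt_const (by norm_num : (0 : ℝ) < 1)).mono fun k hk => hk.le

end Summit.QuantumFields.QCD.Theorems.HonestHeavyAnchorSplit
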